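import Mathlib
import Summits.NavierStokesRegularity.NavierStokesRegularity.Theorems.LevelSetModerationHighSpeedPressureWorkFastSetFrobeniusUnit
import Summits.NavierStokesRegularity.NavierStokesRegularity.Theorems.LevelSetModerationHighSpeedPressureWorkFastSetGradient

/-!
# Route LevelSetModeration — `HighSpeedPressureWork`: overshoot × Frobenius gradient on the fast set, and the linear rotation law at margin zero

Support file for item stmt-NavierStokesRegularity-18149 (`HighSpeedPressureWork`), line
`iso-speed-area-closure`, stub `stub_earlyBookkeeping` in its anatomy
`EarlyBookkeeping ↔ EarlySliceLaw ∧ EarlyRotationLaw` (`…EarlyAnatomyTools`, lead c1). From the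
unit form `levelSetModeration_fastSetFrobenius_unit`:

* `levelSetModeration_fastSetFrobenius_of_speed_le` — scale-invariant form under a speed bound
  `G`: `(|u(t,x)| - B₀) |∇u(t,x)|²_F ≤ A G⁵/ν²` at fast points, `t ≤ ε ν B₀²/G⁴`
  (scaling `u ↦ G⁻¹ u(νt/G², νx/G)`);
* `levelSetModeration_fastSetFrobenius` — the data class of the crux, margin zero:
  `(|u(τ,x)| - B₀) |∇u(τ,x)|²_F ≤ A B₀⁵/ν²` on `{|u(τ)| > B₀}`, `τ ≤ ε ν/B₀²`
  (speed `≤ 2B₀` in the early window);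
* `levelSetModeration_earlyRotation_le` / `levelSetModeration_earlyRotation_linear` — the
  **LINEAR ROTATION LAW at margin zero**: the rotation term of the exact level-set balance,
  `R_c(t) = ∫₀ᵗ∫ 1_{|u|>c}(1 - c/|u|)(|∇u|²_F - |∇|u||²)`, obeys `R_c(t) ≤ (A B₀⁴/ν²) V_c(t)`,
  i.e. `ν R_c(t) ≤ (A B₀⁴/ν) V_c(t)`, for every `c ≥ B₀` and `t ≤ min T (εν/B₀²)`
  (pointwise: `(1 - c/|u|)|∇u|²_F ≤ ((|u| - B₀)/B₀)|∇u|²_F ≤ A B₀⁴/ν²` on the fast set).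

With the Hölder pairing bound (`…PairingHolder`) this localises the early rotation law
`ν R_c(t) ≤ √(F V_c(T)) √(D_c(T))` of the anatomy: it holds whenever `D_c(T) ≥ (A²B₀⁸/(ν²F)) V_c(t)`
(this file) or `V_c(t) ≳ t` (Hölder), so it can fail only on fast sets that are simultaneously of
vanishing volume fraction and of vanishing dissipation density.
-/

noncomputable section

-- single-conjunct summit: `Summit.<Summit>.<Problem>` repeats the name by the D-0017 layout
set_option linter.dupNamespace false

namespace Summit.NavierStokesRegularity.NavierStokesRegularity.Theorems

open MeasureTheory Set Filter Topology Function
open scoped ENNReal RealInnerProductSpace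
open Literature.Analysis.FluidPDE

/-! ### Frobenius norm under scaling -/

/-- `|c • (L ∘ (d • id))|²_F = c² d² |L|²_F`. [folklore] -/
theorem fastSet_frobeniusNormSq_smul_comp_smul {E F : Type*} [NormedAddCommGroup E]
    [InnerProductSpace ℝ E] [FiniteDimensional ℝ E] [NormedAddCommGroup F] [InnerProductSpace ℝ F]
    (L : E →L[ℝ] F) (c d : ℝ) :
    frobeniusNormSq (c • L.comp (d • ContinuousLinearMap.id ℝ E)) = c ^ 2 * d ^ 2 * frobeniusNormSq L := by
  unfold frobeniusNormSq
  rw [Finset.mul_sum]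
  refine Finset.sum_congr rfl fun i _ => ?_
  have h : ∀ v, (c • L.comp (d • ContinuousLinearMap.id ℝ E)) v = c • L (d • v) := fun v => rfl
  simp only [h, map_smul, norm_smul, Real.norm_eq_abs, mul_pow, sq_abs]
  ring

/-! ### General viscosity and speed bound: the scale-invariant form -/

/-- **Overshoot × Frobenius gradient on the fast set under a speed bound (scale-invariant
form).** There are absolute `A ≥ 0`, `ε > 0` such that: for `ν > 0`, `G > 0`, every classical
solution with viscosity `ν` on `ℝ³ × [0, T)` bounded by `G` on `[0, T'] × ℝ³` (`T' < T`), with slices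
uniformly in `L²` there, and with `‖u(0,·)‖ ≤ B₀`, `0 < B₀ ≤ G`, satisfies, at every `t ∈ (0, T')`
with `t ≤ ε ν B₀²/G⁴` and every fast point `x` (`‖u(t,x)‖ > B₀`):
`(‖u(t,x)‖ - B₀) |∇u(t,x)|²_F ≤ A G⁵/ν²` (scaling of `levelSetModeration_fastSetFrobenius_unit`).
[folklore] -/
theorem levelSetModeration_fastSetFrobenius_of_speed_le :
    ∃ A ε : ℝ, 0 ≤ A ∧ 0 < ε ∧ ∀ {ν T T' G B₀ : ℝ}
      {u : ℝ → EuclideanSpace ℝ (Fin 3) → EuclideanSpace ℝ (Fin 3)}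
      {p : ℝ → EuclideanSpace ℝ (Fin 3) → ℝ}, 0 < ν → 0 < G →
      IsClassicalNSSolutionOn (Ico 0 T) ν 0 u p → 0 < T' → T' < T →
      (∀ t ∈ Icc 0 T', ∀ x, ‖u t x‖ ≤ G) → ∀ {K : ℝ≥0∞}, K ≠ ∞ →
      (∀ t ∈ Icc 0 T', eLpNorm (u t) 2 volume ≤ K) → 0 < B₀ → B₀ ≤ G → (∀ x, ‖u 0 x‖ ≤ B₀) →
      ∀ t ∈ Ioo 0 T', t ≤ ε * ν * B₀ ^ 2 / G ^ 4 → ∀ x, B₀ < ‖u t x‖ →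
        (‖u t x‖ - B₀) * frobeniusNormSq (fderiv ℝ (u t) x) ≤ A * G ^ 5 / ν ^ 2 := by
  obtain ⟨A, ε, hA0, hε, hunit⟩ := levelSetModeration_fastSetFrobenius_unit
  refine ⟨A, ε, hA0, hε, ?_⟩
  intro ν T T' G B₀ u p hν hG hcl hT' hT'T hbd K hK hL2 hB₀ hB₀G hB0 t ht htε x hfast
  -- scaling parameters
  set α : ℝ := G⁻¹ with hα
  set γ : ℝ := ν / G with hγ
  set β : ℝ := ν / G ^ 2 with hβ
  have hαpos : 0 < α := by rw [hα]; positivity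
  have hγpos : 0 < γ := by rw [hγ]; positivity
  have hβpos : 0 < β := by rw [hβ]; positivity
  have hβαγ : β = α * γ := by rw [hβ, hα, hγ]; field_simp
  have hcl' := hcl.stRescale hαpos hγpos hβαγ 0 0
  have hS : ((fun r => (0 : ℝ) + β * r) ⁻¹' Ico 0 T) = Ico 0 (T / β) := by
    ext r
    simp only [mem_preimage, mem_Ico, zero_add]
    constructor
    · rintro ⟨h1, h2⟩
      exact ⟨nonneg_of_mul_nonneg_right h1 hβpos, (lt_div_iff₀' hβpos).2 h2⟩
    · rintro ⟨h1, h2⟩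
      exact ⟨mul_nonneg hβpos.le h1, (lt_div_iff₀' hβpos).1 h2⟩
  have hν1 : α * ν / γ = 1 := by rw [hα, hγ]; field_simp
  rw [hS, hν1, smul_stPull_zero] at hcl'
  set w : ℝ → EuclideanSpace ℝ (Fin 3) → EuclideanSpace ℝ (Fin 3) := α • stPull β γ 0 0 u with hw
  have hwapp : ∀ s y, w s y = α • u (β * s) (γ • y) := by
    intro s y
    simp only [hw, Pi.smul_apply, stPull_apply, zero_add]
  have hT'β : 0 < T' / β := div_pos hT' hβpos
  have hT'βT : T' / β < T / β := div_lt_div_of_pos_right hT'T hβpos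
  have hmemI : ∀ {s : ℝ}, s ∈ Icc 0 (T' / β) → β * s ∈ Icc 0 T' := by
    intro s hs
    refine ⟨mul_nonneg hβpos.le hs.1, ?_⟩
    have := hs.2
    rwa [le_div_iff₀' hβpos] at this
  have hbd' : ∀ s ∈ Icc 0 (T' / β), ∀ y, ‖w s y‖ ≤ 1 := by
    intro s hs y
    rw [hwapp, norm_smul, Real.norm_of_nonneg hαpos.le, hα]
    have := hbd (β * s) (hmemI hs) (γ • y)
    calc G⁻¹ * ‖u (β * s) (γ • y)‖ ≤ G⁻¹ * G := by gcongr
      _ = 1 := inv_mul_cancel₀ hG.ne'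
  set K' : ℝ≥0∞ := ENNReal.ofReal |α| * (ENNReal.ofReal (γ ^ 3)⁻¹) ^ (1 / 2 : ℝ) * K with hK'
  have hK'top : K' ≠ ∞ := by
    refine ENNReal.mul_ne_top (ENNReal.mul_ne_top ENNReal.ofReal_ne_top ?_) hK
    exact ENNReal.rpow_ne_top_of_nonneg (by norm_num) ENNReal.ofReal_ne_top
  have hL2' : ∀ s ∈ Icc 0 (T' / β), eLpNorm (w s) 2 volume ≤ K' := by
    intro s hs
    have h1 : w s = fun y => α • u (β * s) ((0 : EuclideanSpace ℝ (Fin 3)) + γ • y) := by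
      funext y; rw [hwapp, zero_add]
    rw [h1]
    refine (eLpNorm_two_smul_comp_affine_le α hγpos 0).trans ?_
    rw [hK']
    gcongr
    exact hL2 (β * s) (hmemI hs)
  -- the datum bound `B = B₀/G ∈ (0, 1]`
  set B : ℝ := α * B₀ with hB
  have hBpos : 0 < B := by rw [hB]; positivity
  have hB1 : B ≤ 1 := by
    rw [hB, hα]
    calc G⁻¹ * B₀ ≤ G⁻¹ * G := by gcongr
      _ = 1 := inv_mul_cancel₀ hG.ne'
  have hB0' : ∀ y, ‖w 0 y‖ ≤ B := by
    intro y
    rw [hwapp, mul_zero, norm_smul, Real.norm_of_nonneg hαpos.le, hB]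
    exact mul_le_mul_of_nonneg_left (hB0 _) hαpos.le
  -- the rescaled time, window and fastness
  have htβ : t / β ∈ Ioo 0 (T' / β) := ⟨div_pos ht.1 hβpos, div_lt_div_of_pos_right ht.2 hβpos⟩
  have hB2 : B ^ 2 = B₀ ^ 2 / G ^ 2 := by rw [hB, hα]; field_simp
  have hwin : t / β ≤ ε * B ^ 2 := by
    rw [div_le_iff₀ hβpos, hB2, hβ]
    refine htε.trans (le_of_eq ?_)
    field_simp
  have hnorm_w : ‖w (t / β) (γ⁻¹ • x)‖ = α * ‖u t x‖ := by
    rw [hwapp, mul_div_cancel₀ _ hβpos.ne', smul_smul, mul_inv_cancel₀ hγpos.ne', one_smul,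
      norm_smul, Real.norm_of_nonneg hαpos.le]
  have hfast' : B < ‖w (t / β) (γ⁻¹ • x)‖ := by
    rw [hnorm_w, hB]
    exact mul_lt_mul_of_pos_left hfast hαpos
  have key := hunit hcl' hT'β hT'βT hbd' hK'top hL2' hBpos hB1 hB0' (t / β) htβ hwin (γ⁻¹ • x)
    hfast'
  -- undo the scaling: `u t = α⁻¹ • w (t/β) (γ⁻¹ • ·)`
  have hU : u t = fun y => α⁻¹ • w (t / β) (γ⁻¹ • y) := by
    funext y
    rw [hwapp, mul_div_cancel₀ _ hβpos.ne', smul_smul, smul_smul, inv_mul_cancel₀ hαpos.ne',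
      mul_inv_cancel₀ hγpos.ne', one_smul, one_smul]
  have hwt : Differentiable ℝ (w (t / β)) :=
    (hcl'.contDiff_velocity ⟨htβ.1.le, htβ.2.trans hT'βT⟩).differentiable (by simp)
  have hlin : HasFDerivAt (fun y : EuclideanSpace ℝ (Fin 3) => γ⁻¹ • y)
      (γ⁻¹ • ContinuousLinearMap.id ℝ (EuclideanSpace ℝ (Fin 3))) x :=
    (hasFDerivAt_id x).const_smul γ⁻¹
  have hcomp : HasFDerivAt (fun y => α⁻¹ • w (t / β) (γ⁻¹ • y))
      (α⁻¹ • ((fderiv ℝ (w (t / β)) (γ⁻¹ • x)).comp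
        (γ⁻¹ • ContinuousLinearMap.id ℝ (EuclideanSpace ℝ (Fin 3))))) x :=
    ((hwt (γ⁻¹ • x)).hasFDerivAt.comp x hlin).const_smul α⁻¹
  have hDu : fderiv ℝ (u t) x = α⁻¹ • ((fderiv ℝ (w (t / β)) (γ⁻¹ • x)).comp
      (γ⁻¹ • ContinuousLinearMap.id ℝ (EuclideanSpace ℝ (Fin 3)))) := by
    rw [hU]; exact hcomp.fderiv
  have hfrob : frobeniusNormSq (fderiv ℝ (u t) x) =
      α⁻¹ ^ 2 * γ⁻¹ ^ 2 * frobeniusNormSq (fderiv ℝ (w (t / β)) (γ⁻¹ • x)) := by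
    rw [hDu, fastSet_frobeniusNormSq_smul_comp_smul]
  have hover : ‖u t x‖ - B₀ = α⁻¹ * (‖w (t / β) (γ⁻¹ • x)‖ - B) := by
    rw [hnorm_w, hB, ← mul_sub, ← mul_assoc, inv_mul_cancel₀ hαpos.ne', one_mul]
  have hprod0 : 0 ≤ ‖w (t / β) (γ⁻¹ • x)‖ - B := by linarith [hfast'.le]
  have hfrob0 : 0 ≤ frobeniusNormSq (fderiv ℝ (w (t / β)) (γ⁻¹ • x)) :=
    Finset.sum_nonneg fun i _ => sq_nonneg _
  have hαγ : α⁻¹ * (α⁻¹ ^ 2 * γ⁻¹ ^ 2) = G ^ 5 / ν ^ 2 := by rw [hα, hγ]; field_simp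
  calc (‖u t x‖ - B₀) * frobeniusNormSq (fderiv ℝ (u t) x)
      = α⁻¹ * (α⁻¹ ^ 2 * γ⁻¹ ^ 2) *
          ((‖w (t / β) (γ⁻¹ • x)‖ - B) * frobeniusNormSq (fderiv ℝ (w (t / β)) (γ⁻¹ • x))) := by
        rw [hover, hfrob]; ring
    _ ≤ α⁻¹ * (α⁻¹ ^ 2 * γ⁻¹ ^ 2) * A :=
        mul_le_mul_of_nonneg_left key (by positivity)
    _ = A * G ^ 5 / ν ^ 2 := by rw [hαγ]; ring

/-! ### The data class of the crux: the early window -/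

/-- **Overshoot × Frobenius gradient at margin zero for the data class of the crux.** There are
absolute `A ≥ 0`, `ε > 0` such that every classical solution of the unforced Navier–Stokes system
on `ℝ³ × [0,T)` (`ν, T > 0`) that is Leray–Hopf from a rapidly decaying datum with `‖u(0,·)‖ ≤ B₀`
(`B₀ > 0`) satisfies, at every `τ ∈ (0,T)` with `τ ≤ ε ν/B₀²` and every fast point `x`
(`‖u(τ,x)‖ > B₀`): `(‖u(τ,x)‖ - B₀) · |∇u(τ,x)|²_F ≤ A B₀⁵/ν²` (speed `≤ 2B₀` in the early window,
`levelSetModeration_earlyWindow`; `levelSetModeration_fastSetFrobenius_of_speed_le` with `G = 2B₀`).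
On the fast set the overshoot kills the parabolic singularity of the full gradient. [folklore] -/
theorem levelSetModeration_fastSetFrobenius :
    ∃ A ε : ℝ, 0 ≤ A ∧ 0 < ε ∧ ∀ (ν T : ℝ) (u : ℝ → EuclideanSpace ℝ (Fin 3) → EuclideanSpace ℝ (Fin 3)) (p : ℝ → EuclideanSpace ℝ (Fin 3) → ℝ), 0 < ν → 0 < T → Literature.Analysis.FluidPDE.IsClassicalNSSolutionOn (Set.Ico 0 T) ν 0 u p → Literature.Analysis.FluidPDE.IsLerayHopfOn T ν 0 (u 0) u → Literature.Analysis.FluidPDE.HasRapidSpatialDecay (u 0) → ∀ B₀ : ℝ, 0 < B₀ → (∀ x, ‖u 0 x‖ ≤ B₀) → ∀ τ ∈ Set.Ioo 0 T, τ ≤ ε * ν / B₀ ^ 2 → ∀ x, B₀ < ‖u τ x‖ → (‖u τ x‖ - B₀) * Literature.Analysis.FluidPDE.frobeniusNormSq (fderiv ℝ (u τ) x) ≤ A * B₀ ^ 5 / ν ^ 2 := by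
  obtain ⟨c₀, hc₀, hW⟩ := levelSetModeration_earlyWindow
  obtain ⟨A, ε, hA0, hε, hG⟩ := levelSetModeration_fastSetFrobenius_of_speed_le
  refine ⟨32 * A, min (c₀ / 2) (ε / 16), by positivity, lt_min (by positivity) (by positivity), ?_⟩
  intro ν T u p hν hT hcl hLH hdec B₀ hB₀ hbd0 τ hτ hτε x hfast
  -- the horizon `T' = (τ + T₁)/2`, `T₁ = min T (c₀ν/B₀²)`
  set T₁ : ℝ := min T (c₀ * ν / B₀ ^ 2) with hT₁
  have hτc₀ : τ < c₀ * ν / B₀ ^ 2 := by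
    have h1 : τ ≤ c₀ / 2 * ν / B₀ ^ 2 := hτε.trans
      (div_le_div_of_nonneg_right (mul_le_mul_of_nonneg_right (min_le_left _ _) hν.le)
        (by positivity))
    have h2 : c₀ / 2 * ν / B₀ ^ 2 < c₀ * ν / B₀ ^ 2 :=
      div_lt_div_of_pos_right (by nlinarith) (by positivity)
    exact h1.trans_lt h2
  have hτT₁ : τ < T₁ := lt_min hτ.2 hτc₀
  set T' : ℝ := (τ + T₁) / 2 with hT'
  have hτT' : τ < T' := by rw [hT']; linarith
  have hT'T₁ : T' < T₁ := by rw [hT']; linarith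
  have hT'pos : 0 < T' := hτ.1.trans hτT'
  have hT'T : T' < T := hT'T₁.trans_le (min_le_left _ _)
  have hT'c : T' < c₀ * ν / B₀ ^ 2 := hT'T₁.trans_le (min_le_right _ _)
  -- speed `≤ 2B₀` on `[0, T']`
  have hbd : ∀ s ∈ Icc 0 T', ∀ y, ‖u s y‖ ≤ 2 * B₀ := fun s hs y =>
    (hW ν T u p hν hT hcl hLH hdec B₀ hB₀ hbd0 s ⟨hs.1, hs.2.trans_lt hT'T⟩
      (hs.2.trans_lt hT'c)).1 y
  -- uniform `L²` bound of the slices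
  set KK : ℝ≥0∞ := (ENNReal.ofReal (∫ x, ‖u 0 x‖ ^ 2)) ^ (1 / 2 : ℝ) with hKK
  have hKKtop : KK ≠ ⊤ := ENNReal.rpow_ne_top_of_nonneg (by norm_num) ENNReal.ofReal_ne_top
  have hL2 : ∀ s ∈ Icc 0 T', eLpNorm (u s) 2 volume ≤ KK := by
    intro s hs
    have h := lintegral_enorm_sq_le_of_lerayHopf hLH hν.le ⟨hs.1, hs.2.trans hT'T.le⟩
    rw [eLpNorm_eq_lintegral_rpow_enorm_toReal (by norm_num) (by norm_num), ENNReal.toReal_ofNat,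
      hKK]
    refine ENNReal.rpow_le_rpow ?_ (by norm_num)
    refine le_trans (le_of_eq ?_) h
    exact lintegral_congr fun x => by rw [ENNReal.rpow_two]
  -- the window `τ ≤ ε ν B₀²/(2B₀)⁴`
  have hτw : τ ≤ ε * ν * B₀ ^ 2 / (2 * B₀) ^ 4 := by
    have h1 : τ ≤ ε / 16 * ν / B₀ ^ 2 := hτε.trans
      (div_le_div_of_nonneg_right (mul_le_mul_of_nonneg_right (min_le_right _ _) hν.le)
        (by positivity))
    refine h1.trans (le_of_eq ?_)
    field_simp
    ring
  have key := hG hν (by positivity : (0 : ℝ) < 2 * B₀) hcl hT'pos hT'T hbd hKKtop hL2 hB₀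
    (by linarith) hbd0 τ ⟨hτ.1, hτT'⟩ hτw x hfast
  refine key.trans (le_of_eq ?_)
  ring

/-! ### The linear rotation law at margin zero -/

/-- **Pointwise rotation density bound on the fast set.** If
`(‖u τ x‖ - B₀) |∇u(τ,x)|²_F ≤ A B₀⁵/ν²` at the fast points of the early window (the conclusion of
`levelSetModeration_fastSetFrobenius` for one solution), then for every level `c ≥ B₀`, every such
`τ` and every `x` with `c < ‖u τ x‖`:
`(1 - c/‖u‖)(|∇u|²_F - ‖D|u|‖²) ≤ A B₀⁴/ν²` (drop `‖D|u|‖² ≥ 0`; `1 - c/‖u‖ ≤ (‖u‖ - B₀)/B₀`).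
[folklore] -/
theorem levelSetModeration_rotationDensity_le {A ε ν T B₀ : ℝ}
    {u : ℝ → EuclideanSpace ℝ (Fin 3) → EuclideanSpace ℝ (Fin 3)}
    (hAF : ∀ τ ∈ Set.Ioo 0 T, τ ≤ ε * ν / B₀ ^ 2 → ∀ x, B₀ < ‖u τ x‖ →
      (‖u τ x‖ - B₀) * frobeniusNormSq (fderiv ℝ (u τ) x) ≤ A * B₀ ^ 5 / ν ^ 2)
    {c τ : ℝ} (hB₀ : 0 < B₀) (hc : B₀ ≤ c) (hτ : τ ∈ Ioo 0 T) (hτε : τ ≤ ε * ν / B₀ ^ 2)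
    {x : EuclideanSpace ℝ (Fin 3)} (hx : c < ‖u τ x‖) :
    (1 - c / ‖u τ x‖) * (frobeniusNormSq (fderiv ℝ (u τ) x) -
        ‖fderiv ℝ (fun y => ‖u τ y‖) x‖ ^ 2) ≤ A * B₀ ^ 4 / ν ^ 2 := by
  have hux : B₀ < ‖u τ x‖ := hc.trans_lt hx
  have hu0 : 0 < ‖u τ x‖ := hB₀.trans hux
  have h1 : 0 ≤ 1 - c / ‖u τ x‖ := by
    rw [sub_nonneg, div_le_one hu0]; exact hx.le
  have hfrob0 : 0 ≤ frobeniusNormSq (fderiv ℝ (u τ) x) :=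
    Finset.sum_nonneg fun i _ => sq_nonneg _
  have h2 : 1 - c / ‖u τ x‖ ≤ (‖u τ x‖ - B₀) / B₀ := by
    have ha : 1 - c / ‖u τ x‖ ≤ 1 - B₀ / ‖u τ x‖ := by
      gcongr
    have hb : 1 - B₀ / ‖u τ x‖ = (‖u τ x‖ - B₀) / ‖u τ x‖ := by
      field_simp
    have hc' : (‖u τ x‖ - B₀) / ‖u τ x‖ ≤ (‖u τ x‖ - B₀) / B₀ :=
      div_le_div_of_nonneg_left (by linarith) hB₀ hux.le
    linarith
  have key := hAF τ hτ hτε x hux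
  calc (1 - c / ‖u τ x‖) * (frobeniusNormSq (fderiv ℝ (u τ) x) -
        ‖fderiv ℝ (fun y => ‖u τ y‖) x‖ ^ 2)
      ≤ (1 - c / ‖u τ x‖) * frobeniusNormSq (fderiv ℝ (u τ) x) := by
        refine mul_le_mul_of_nonneg_left ?_ h1
        linarith [sq_nonneg ‖fderiv ℝ (fun y => ‖u τ y‖) x‖]
    _ ≤ (‖u τ x‖ - B₀) / B₀ * frobeniusNormSq (fderiv ℝ (u τ) x) :=
        mul_le_mul_of_nonneg_right h2 hfrob0
    _ = B₀⁻¹ * ((‖u τ x‖ - B₀) * frobeniusNormSq (fderiv ℝ (u τ) x)) := by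
        rw [div_eq_mul_inv]; ring
    _ ≤ B₀⁻¹ * (A * B₀ ^ 5 / ν ^ 2) := mul_le_mul_of_nonneg_left key (by positivity)
    _ = A * B₀ ^ 4 / ν ^ 2 := by field_simp

/-- **The linear rotation law at margin zero.** There are absolute `A ≥ 0`, `ε > 0` such that for
every classical Leray–Hopf solution on `ℝ³ × [0,T)` from a rapidly decaying datum with `|u₀| ≤ B₀`
(`B₀ > 0`), every level `c ≥ B₀` and every `t ≤ min T (εν/B₀²)`, the ROTATION TERM of the exact
level-set balance obeys

  `∫₀ᵗ∫ 1_{c<|u|} (1 - c/|u|)(|∇u|²_F - ‖D|u|‖²) ≤ (A B₀⁴/ν²) · ∫₀ᵗ |{c < |u(τ)|}| dτ`,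

i.e. `R_c(t) ≤ (A B₀⁴/ν²) V_c(t)` (pointwise bound `levelSetModeration_rotationDensity_le` from
`levelSetModeration_fastSetFrobenius`, integrated over the fast set). [folklore] -/
theorem levelSetModeration_earlyRotation_le :
    ∃ A ε : ℝ, 0 ≤ A ∧ 0 < ε ∧ ∀ (ν T : ℝ) (u : ℝ → EuclideanSpace ℝ (Fin 3) → EuclideanSpace ℝ (Fin 3)) (p : ℝ → EuclideanSpace ℝ (Fin 3) → ℝ), 0 < ν → 0 < T → Literature.Analysis.FluidPDE.IsClassicalNSSolutionOn (Set.Ico 0 T) ν 0 u p → Literature.Analysis.FluidPDE.IsLerayHopfOn T ν 0 (u 0) u → Literature.Analysis.FluidPDE.HasRapidSpatialDecay (u 0) → ∀ B₀ : ℝ, 0 < B₀ → (∀ x, ‖u 0 x‖ ≤ B₀) → ∀ (c t : ℝ), B₀ ≤ c → t ≤ T → t ≤ ε * ν / B₀ ^ 2 → (∫⁻ τ in Set.Ioo 0 t, ∫⁻ x, Set.indicator {x | c < ‖u τ x‖} (fun x => ENNReal.ofReal ((1 - c / ‖u τ x‖) * (Literature.Analysis.FluidPDE.frobeniusNormSq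 (fderiv ℝ (u τ) x) - ‖fderiv ℝ (fun y => ‖u τ y‖) x‖ ^ 2))) x) ≤ ENNReal.ofReal (A * B₀ ^ 4 / ν ^ 2) * ∫⁻ τ in Set.Ioo 0 t, MeasureTheory.volume {x | c < ‖u τ x‖} := by
  obtain ⟨A, ε, hA0, hε, hF⟩ := levelSetModeration_fastSetFrobenius
  refine ⟨A, ε, hA0, hε, ?_⟩
  intro ν T u p hν hT hcl hLH hdec B₀ hB₀ hbd c t hc htT htε
  have hAF := hF ν T u p hν hT hcl hLH hdec B₀ hB₀ hbd
  set K : ℝ≥0∞ := ENNReal.ofReal (A * B₀ ^ 4 / ν ^ 2) with hK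
  -- slice by slice
  have hslice : ∀ τ ∈ Ioo 0 t, (∫⁻ x, {x | c < ‖u τ x‖}.indicator (fun x => ENNReal.ofReal
      ((1 - c / ‖u τ x‖) * (frobeniusNormSq (fderiv ℝ (u τ) x) -
        ‖fderiv ℝ (fun y => ‖u τ y‖) x‖ ^ 2))) x) ≤ K * volume {x | c < ‖u τ x‖} := by
    intro τ hτ
    have hτT : τ ∈ Ioo 0 T := ⟨hτ.1, hτ.2.trans_le htT⟩
    have hτε : τ ≤ ε * ν / B₀ ^ 2 := hτ.2.le.trans htε
    have hA : MeasurableSet {x | c < ‖u τ x‖} :=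
      (isOpen_lt continuous_const (hcl.contDiff_velocity ⟨hτT.1.le, hτT.2⟩).continuous.norm).measurableSet
    rw [← lintegral_indicator_const hA]
    refine lintegral_mono fun x => ?_
    by_cases hx : x ∈ {x | c < ‖u τ x‖}
    · rw [indicator_of_mem hx, indicator_of_mem hx, hK]
      exact ENNReal.ofReal_le_ofReal
        (levelSetModeration_rotationDensity_le hAF hB₀ hc hτT hτε hx)
    · rw [indicator_of_notMem hx, indicator_of_notMem hx]
  calc (∫⁻ τ in Ioo 0 t, ∫⁻ x, {x | c < ‖u τ x‖}.indicator (fun x => ENNReal.ofReal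
        ((1 - c / ‖u τ x‖) * (frobeniusNormSq (fderiv ℝ (u τ) x) -
          ‖fderiv ℝ (fun y => ‖u τ y‖) x‖ ^ 2))) x)
      ≤ ∫⁻ τ in Ioo 0 t, K * volume {x | c < ‖u τ x‖} :=
        setLIntegral_mono' measurableSet_Ioo fun τ hτ => hslice τ hτ
    _ = K * ∫⁻ τ in Ioo 0 t, volume {x | c < ‖u τ x‖} :=
        lintegral_const_mul' _ _ ENNReal.ofReal_ne_top

/-- **The linear rotation law, real form** (`ν R_c(t) ≤ A (B₀⁴/ν) V_c(t)`, the two functionals as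
`toReal`s of the extended integrals, `V_c(t) < ∞` by the energy inequality): with the constants of
`levelSetModeration_earlyRotation_le`, for `c ≥ B₀` and `t ≤ min T (εν/B₀²)`. In the anatomy
`EarlyBookkeeping ↔ EarlySliceLaw ∧ EarlyRotationLaw` of the early stub the rotation law asks for
`ν R_c(t) ≤ √(F V_c(T)) √(D_c(T))`; by this linear law that can fail only where
`D_c(T) < (A²B₀⁸/(ν⁴ F)) ν² V_c(t)`, i.e. on fast sets of small dissipation density. [folklore] -/
theorem levelSetModeration_earlyRotation_linear :
    ∃ A ε : ℝ, 0 ≤ A ∧ 0 < ε ∧ ∀ (ν T : ℝ) (u : ℝ → EuclideanSpace ℝ (Fin 3) → EuclideanSpace ℝ (Fin 3)) (p : ℝ → EuclideanSpace ℝ (Fin 3) → ℝ), 0 < ν → 0 < T → Literature.Analysis.FluidPDE.IsClassicalNSSolutionOn (Set.Ico 0 T) ν 0 u p → Literature.Analysis.FluidPDE.IsLerayHopfOn T ν 0 (u 0) u → Literature.Analysis.FluidPDE.HasRapidSpatialDecay (u 0) → ∀ B₀ : ℝ, 0 < B₀ → (∀ x, ‖u 0 x‖ ≤ B₀) → ∀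 (c t : ℝ), B₀ ≤ c → t ≤ T → t ≤ ε * ν / B₀ ^ 2 → ν * (∫⁻ τ in Set.Ioo 0 t, ∫⁻ x, Set.indicator {x | c < ‖u τ x‖} (fun x => ENNReal.ofReal ((1 - c / ‖u τ x‖) * (Literature.Analysis.FluidPDE.frobeniusNormSq (fderiv ℝ (u τ) x) - ‖fderiv ℝ (fun y => ‖u τ y‖) x‖ ^ 2))) x).toReal ≤ A * (B₀ ^ 4 / ν) * (∫⁻ τ in Set.Ioo 0 t, MeasureTheory.volume {x | c < ‖u τ x‖}).toReal := by
  obtain ⟨A, ε, hA0, hε, hR⟩ := levelSetModeration_earlyRotation_le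
  refine ⟨A, ε, hA0, hε, ?_⟩
  intro ν T u p hν hT hcl hLH hdec B₀ hB₀ hbd c t hc htT htε
  have hc0 : 0 < c := hB₀.trans_le hc
  set Vt : ℝ≥0∞ := ∫⁻ τ in Ioo 0 t, volume {x | c < ‖u τ x‖} with hVt
  have hVtfin : Vt ≠ ⊤ := by
    refine ne_top_of_le_ne_top ?_ (lintegral_mono_set (Ioo_subset_Ioo le_rfl htT))
    exact ne_top_of_le_ne_top ENNReal.ofReal_ne_top (levelSetVolume_le hLH hν.le hT.le hc0)
  have h := hR ν T u p hν hT hcl hLH hdec B₀ hB₀ hbd c t hc htT htε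
  have hreal := ENNReal.toReal_mono (ENNReal.mul_ne_top ENNReal.ofReal_ne_top hVtfin) h
  rw [ENNReal.toReal_mul, ENNReal.toReal_ofReal (by positivity)] at hreal
  calc ν * (∫⁻ τ in Ioo 0 t, ∫⁻ x, {x | c < ‖u τ x‖}.indicator (fun x => ENNReal.ofReal
        ((1 - c / ‖u τ x‖) * (frobeniusNormSq (fderiv ℝ (u τ) x) -
          ‖fderiv ℝ (fun y => ‖u τ y‖) x‖ ^ 2))) x).toReal
      ≤ ν * (A * B₀ ^ 4 / ν ^ 2 * Vt.toReal) := mul_le_mul_of_nonneg_left hreal hν.le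
    _ = A * (B₀ ^ 4 / ν) * Vt.toReal := by field_simp

end Summit.NavierStokesRegularity.NavierStokesRegularity.Theorems

end
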